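import Summits.PneNP.PneNP.Theses.MetaCplx
import Literature.Computability.Cryptography.OneWayFunctionsPneNP
import Literature.Computability.Cryptography.Sweep1S25Proofs
import Literature.Computability.Cryptography.LiuPassMainTheorem
import Literature.Computability.Cryptography.AverageCaseHolds
import Literature.Computability.MetaComplexity.DistProblemsProofs
import Literature.Computability.MetaComplexity.HeuristicClassesDeterministicProofs
import Literature.Computability.MetaComplexity.HeuristicClassesAmplificationProofs
import Literature.Computability.MetaComplexity.UniversalMachineProofs
import Literature.Computability.Complexity.ProbabilisticClassesProofs

/-!
# Census probes for the RESTATED deciding crux `MetacplxThesis` (stmt-PneNP-10656)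

Planner-side evidence (crux-strategist, unit cstrat-stmt-PneNP-10656-r1). Kernel-checked facts used
by `STRATEGY-CENSUS.md`: for each candidate decomposition `X ⇐ X₁ ∧ … ∧ X_k` of
`X = MetacplxThesis = ∃ f, IsOneWay f`, the assembly (b) and the (c)-status of its pieces
("does a piece give the Statement `PneNP` or `X` on its own?"), plus the ANATOMY theorem
`MetacplxThesis ↔ PneNP ∧ (worst-to-average bridge) ∧ MetacplxNoPessiland`.
Nothing here is a route item; nothing is proposed to the tree.
-/

namespace Summit.PneNP.PneNP.Cruxes.MetacplxThesis.Census

open Summit.PneNP.PneNP.Theses.MetaCplx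
open Literature.Computability.Complexity Literature.Computability.Complexity.Nondeterministic
open Literature.Computability.MetaComplexity Literature.Computability.Cryptography

/-! ## 0. The Statement versus `NP ⊄ P` (model bridges, both directions) -/

theorem pneNP_of_NP_not_subset_P (h : ¬ (NP ⊆ Classes.P)) : _root_.PneNP :=
  pneNP_shape_of_NP_not_subset_P h

theorem NP_not_subset_P_of_pneNP (h : _root_.PneNP) : ¬ (NP ⊆ Classes.P) := by
  unfold PneNP Literature.PNP.PNeNP at h
  obtain ⟨L, hL, hLP⟩ := h
  have hP : Literature.Computability.Complexity.PNPWave0.P Bool = Classes.P := P_bool_eq_holds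
  have hN : Literature.Computability.Complexity.PNPWave0.NP Bool = NP := NP_bool_eq_holds
  rw [hP] at hLP
  rw [hN] at hL
  exact fun hsub => hLP (hsub hL)

theorem pneNP_iff_NP_not_subset_P : _root_.PneNP ↔ ¬ (NP ⊆ Classes.P) :=
  ⟨NP_not_subset_P_of_pneNP, pneNP_of_NP_not_subset_P⟩

/-! ## D1. Impagliazzo's worlds: `X ⇐ MetacplxNoHeuristica ∧ MetacplxNoPessiland` -/

/-- (b) the assembly is modus ponens (`trivial_seam`). -/
theorem D1_assembly : MetacplxNoHeuristica → MetacplxNoPessiland → MetacplxThesis :=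
  fun h3 h4 => h4 h3

/-- (c) the piece `MetacplxNoHeuristica` gives the Statement ON ITS OWN, by two landed lemmas:
`(P, 𝒟) ⊆ AvgP` (`distClass_P_subset_AvgP_holds`) and the model bridge. -/
theorem D1_noHeuristica_gives_S : MetacplxNoHeuristica → _root_.PneNP := fun h3 =>
  pneNP_of_NP_not_subset_P fun hNP => h3 fun Q hQ =>
    distClass_P_subset_AvgP_holds ⟨hNP hQ.1, Set.mem_univ _⟩

/-- Anatomy of the piece: `NoHeuristica` is LITERALLY the summit conjoined with the worst-case→
average-case bridge for `NP` (Impagliazzo's exclusion of Heuristica in implication form). -/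
theorem D1_noHeuristica_anatomy :
    MetacplxNoHeuristica ↔ (_root_.PneNP ∧ (¬ (NP ⊆ Classes.P) → MetacplxNoHeuristica)) :=
  ⟨fun h3 => ⟨D1_noHeuristica_gives_S h3, fun _ => h3⟩,
   fun h => h.2 (NP_not_subset_P_of_pneNP h.1)⟩

/-- (c) for the other piece: `MetacplxNoPessiland` is an implication whose hypothesis is
`MetacplxNoHeuristica`; under `NP ⊆ P` it holds vacuously, so it does not give `S`: indeed
`¬ PneNP → MetacplxNoPessiland` (so any proof of `MetacplxNoPessiland → PneNP` would prove `PneNP`). -/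
theorem D1_noPessiland_of_not_S (h : ¬ _root_.PneNP) : MetacplxNoPessiland :=
  fun h3 => absurd (D1_noHeuristica_gives_S h3) h

/-! ## D2. Liu–Pass 2020: `X ⇐ MetacplxKtMildlyHoa ∧ (MetacplxKtMildlyHoa → X)` — a LANDED iff -/

/-- (c) violated by a landed `iff`: the piece is `X` renamed (Liu–Pass Thm 1.1 at `t = 2X`, `ε = 1`). -/
theorem D2_landed_iff : MetacplxKtMildlyHoa ↔ MetacplxThesis := by
  have ht : ∀ n : ℕ, (1 + (1 : ℝ)) * n ≤ (((2 * Polynomial.X : Polynomial ℕ).eval n : ℕ) : ℝ) := by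
    intro n
    simp [Polynomial.eval_mul]
    norm_num
  constructor
  · intro h
    obtain ⟨U⟩ := (UniversalMachine.nonempty_holds : Nonempty UniversalMachine)
    exact (OWFExist_iff_isMildlyHardOnAverage_liuPassKt_holds U (2 * Polynomial.X) one_pos ht).2 (h U)
  · intro h U
    exact (OWFExist_iff_isMildlyHardOnAverage_liuPassKt_holds U (2 * Polynomial.X) one_pos ht).1 h

/-! ## D3. Hirahara 2023 shape: `X ⇐ (NP ⊄ BPP) ∧ (NP-hardness of GapMdKP) ∧ (bridge)` -/

/-- (c) the worst-case piece `NP ⊄ BPP` gives the Statement on its own (`P ⊆ BPP`, landed). -/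
theorem D3_NP_not_subset_BPP_gives_S (h : ¬ (NP ⊆ BPP)) : _root_.PneNP :=
  pneNP_of_NP_not_subset_P fun hNP => h (hNP.trans P_subset_BPP_holds)

/-! ## D4. Sibling conjectures: `X ⇐ IOOWFExist ∧ (IOOWFExist → X)` etc. -/

/-- (c) `IOOWFExist`, `WeakOWFExist`, `NonuniformOWFExist` each give the Statement by LANDED theorems. -/
example (h : Summit.PneNP.PneNP.IOOWFExist) : _root_.PneNP := pneNP_shape_of_IOOWFExist h
example (h : WeakOWFExist) : _root_.PneNP := pneNP_shape_of_WeakOWFExist h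
example (h : NonuniformOWFExist) : _root_.PneNP := pneNP_shape_of_NonuniformOWFExist h
/-- and `WeakOWFExist ↔ X`, `NonuniformOWFExist → X` are landed (Yao; Goldreich Prop. 2.2.7). -/
example : WeakOWFExist ↔ MetacplxThesis := weakOWFExist_iff_OWFExist_holds
example : NonuniformOWFExist → MetacplxThesis := OWFExist_of_nonuniform_holds

/-! ## D5. One level down: `NoHeuristica ⇐ (UP ⊄ DTIME(2^{O(n/log n)})) ∧ hirahara_UP_DistNP` -/

/-- (b) the bridge is LANDED (`hirahara_UP_DistNP_holds`, Hirahara STOC 2021 Thm 1.6). -/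
theorem D5_assembly (h : ¬ UP ⊆ ⋃ c : ℕ, DTIME (fun n => 2 ^ (c * n / Nat.log 2 n))) :
    MetacplxNoHeuristica :=
  hirahara_UP_DistNP_holds h

/-! ## D7. Randomized reading: the piece `DistNP ⊄ HeurBPP` also gives the Statement on its own -/

/-- (c) `¬ DistNP ⊆ HeurBPP → PneNP`: `NP ⊆ P ⟹ DistNP ⊆ (P, PSamp) ⊆ AvgP ⊆ AvgBPP ⊆ HeurBPP` (four landed lemmas). -/
theorem D7_distNP_heur_gives_S (h : ¬ (DistNP ⊆ HeurBPP)) : _root_.PneNP :=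
  pneNP_of_NP_not_subset_P fun hNP => h fun Q hQ =>
    AvgBPP_subset_HeurBPP_holds (AvgP_subset_AvgBPP_holds
      (distClass_P_subset_AvgP_holds ⟨hNP hQ.1, Set.mem_univ _⟩))

/-! ## D9. One level down: the UP-hardness feeder of `NoHeuristica` gives the Statement on its own -/

/-- Arithmetic: `n ^ k ≤ 2 ^ ((3k+2) n / ⌊log₂ n⌋)` for all `n` (for `n ≤ 1` both sides' conventions give `… ≤ 1`). -/
theorem pow_le_two_pow_div_log (k n : ℕ) : n ^ k ≤ 2 ^ ((3 * k + 2) * n / Nat.log 2 n) := by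
  rcases Nat.lt_or_ge n 2 with hn | hn
  · interval_cases n
    · cases k <;> simp
    · simp
  · set B := Nat.log 2 n with hB
    have hnB : n < 2 ^ (B + 1) := Nat.lt_pow_succ_log_self (by norm_num) n
    have hBn : B ≤ n := Nat.log_le_self 2 n
    have h2B : 2 ^ B ≤ n := Nat.pow_log_le_self 2 (by omega)
    have hB1 : 1 ≤ B := by
      rw [hB]
      exact Nat.le_log_of_pow_le (by norm_num) (by simpa using hn)
    have hsq : B * B ≤ 2 * 2 ^ B := by
      have key : ∀ m : ℕ, m * m ≤ 2 * 2 ^ m := by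
        intro m
        induction m with
        | zero => simp
        | succ m ih =>
          have h3 : m < 2 ^ m := Nat.lt_two_pow_self
          have h4 : 2 ^ (m + 1) = 2 * 2 ^ m := by ring
          nlinarith
      exact key B
    have hq : k * (B + 1) * B ≤ (3 * k + 2) * n := by
      have e1 : B * B ≤ 2 * n := le_trans hsq (by omega)
      have e2 : k * (B * B) ≤ k * (2 * n) := Nat.mul_le_mul_left k e1
      have e3 : k * B ≤ k * n := Nat.mul_le_mul_left k hBn
      nlinarith
    have hdiv : k * (B + 1) ≤ (3 * k + 2) * n / B :=
      (Nat.le_div_iff_mul_le (by omega)).2 hq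
    calc n ^ k ≤ (2 ^ (B + 1)) ^ k := Nat.pow_le_pow_left hnB.le k
      _ = 2 ^ (k * (B + 1)) := by rw [← pow_mul, mul_comm]
      _ ≤ 2 ^ ((3 * k + 2) * n / B) := Nat.pow_le_pow_right (by norm_num) hdiv

/-- `P ⊆ DTIME(2^{O(n / log n)})`. -/
theorem P_subset_DTIME_two_pow_div_log :
    Classes.P ⊆ ⋃ c : ℕ, DTIME (fun n => 2 ^ (c * n / Nat.log 2 n)) := by
  intro L hL
  obtain ⟨k, hk⟩ := Set.mem_iUnion.1 hL
  exact Set.mem_iUnion.2 ⟨3 * k + 2, DTIME_mono (fun n => pow_le_two_pow_div_log k n) hk⟩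

/-- (c) the open piece `UP ⊄ DTIME(2^{O(n/log n)})` gives the Statement on its own (`UP ⊆ NP`, landed). -/
theorem D9_UP_piece_gives_S (h : ¬ UP ⊆ ⋃ c : ℕ, DTIME (fun n => 2 ^ (c * n / Nat.log 2 n))) :
    _root_.PneNP :=
  pneNP_of_NP_not_subset_P fun hNP =>
    h ((UP_subset_NP.trans hNP).trans P_subset_DTIME_two_pow_div_log)

/-! ## ANATOMY of the crux: `X` is the summit conjoined with Impagliazzo's two open exclusions -/

/-- `OWF ⇒ DistNP ⊄ AvgP` (Bogdanov–Trevisan Thm 27 / §5.1.3, landed, with `AvgP ⊆ AvgBPP ⊆ HeurBPP`). -/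
theorem noHeuristica_of_thesis (h : MetacplxThesis) : MetacplxNoHeuristica := fun hA =>
  DistNP_not_subset_HeurBPP_of_OWFExist_holds h
    (hA.trans (AvgP_subset_AvgBPP_holds.trans AvgBPP_subset_HeurBPP_holds))

/-- **ANATOMY (errorless reading).** `MetacplxThesis ↔ PneNP ∧ WorstToAvg ∧ MetacplxNoPessiland`,
where `WorstToAvg := ¬ (NP ⊆ P) → ¬ (DistNP ⊆ AvgP)` is the exclusion of Heuristica in bridge form.
So the route's deciding crux is, provably in the tree, the SUMMIT plus two open bridges (each of which
holds vacuously if `P = NP`, hence neither is summit-or-harder). -/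
theorem anatomy :
    MetacplxThesis ↔
      (_root_.PneNP ∧ (¬ (NP ⊆ Classes.P) → MetacplxNoHeuristica) ∧ MetacplxNoPessiland) :=
  ⟨fun h => ⟨closes h, fun _ => noHeuristica_of_thesis h, fun _ => h⟩,
   fun h => h.2.2 (h.2.1 (NP_not_subset_P_of_pneNP h.1))⟩

/-- **ANATOMY (randomized reading, Impagliazzo 1995 Def. 3.5 / Hirahara–Nanashima 2026).**
`MetacplxThesis ↔ PneNP ∧ (¬ NP ⊆ P → ¬ DistNP ⊆ HeurBPP) ∧ (¬ DistNP ⊆ HeurBPP → ∃ f, IsOneWay f)`. -/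
theorem anatomy_heur :
    MetacplxThesis ↔
      (_root_.PneNP ∧ (¬ (NP ⊆ Classes.P) → ¬ (DistNP ⊆ HeurBPP)) ∧
        (¬ (DistNP ⊆ HeurBPP) → ∃ f : List Bool → List Bool, IsOneWay f)) :=
  ⟨fun h => ⟨closes h, fun _ => DistNP_not_subset_HeurBPP_of_OWFExist_holds h, fun _ => h⟩,
   fun h => h.2.2 (h.2.1 (NP_not_subset_P_of_pneNP h.1))⟩

/-- The two bridges of `anatomy` are each implied by `¬ PneNP` (vacuously), so neither gives `S`. -/
theorem bridges_of_not_S (h : ¬ _root_.PneNP) :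
    (¬ (NP ⊆ Classes.P) → MetacplxNoHeuristica) ∧ MetacplxNoPessiland :=
  ⟨fun hNP => absurd (pneNP_of_NP_not_subset_P hNP) h, D1_noPessiland_of_not_S h⟩

/-- **Meta-obstruction (★), propositional core.** If `X₁ ∧ X₂ → X`, `X → S` and `¬ S → X₁`, then
`X₂ → S`: in any two-piece split of a statement at least as strong as `S`, a piece implied by `¬ S`
forces its partner to be summit-or-harder. -/
theorem star {X X₁ X₂ S : Prop} (hA : X₁ → X₂ → X) (hX : X → S) (h₁ : ¬ S → X₁) : X₂ → S :=
  fun h₂ => Classical.byContradiction fun hS => hS (hX (hA (h₁ hS) h₂))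

end Summit.PneNP.PneNP.Cruxes.MetacplxThesis.Census
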